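import Summits.QuantumAdvantage.QuantumAdvantage.Theorems.CubicForrelationNearExactIsExactTwelveLevelFiveRigidRadical

/-!
# Crux `CubicForrelation.NearExactIsExact` (stmt-QuantumAdvantage-14043) — n = 12, open window `(57/64, 29/32)`, a LEVEL-5 side in the RIGID
  case with `4 ∣ e₅` off the odd hyperplane: the SIGN CHARACTER SUMS (partner-free)

Certificate seat `b2b-cforr-cert` (gen 29).  HONEST FRAMING: kernel-checked finite-slice lemmas (standard axioms) about cubic Boolean pairs on 12
bits, consequences of …TwelveLevelFiveRigidRadical (`L₅ = t ⊕ R`, `R = rad B ∩ V`, `#R = 128`): the sign `σ₅ = (−1)^{hb}` is `R`-EQUIVARIANT on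
`P` (`hb(x ⊕ r) = hb(x) ⊕ λ(r)`, `λ(r) = hb(x₀) ⊕ hb(x₀ ⊕ r)` additive on `R`), hence
* `M(y) := Σ_{x∈P} σ₅(x)(−1)^{x·y} ∈ {0, ±512}` (`tzl5_Shat_sq`, `tzl5_SR` with `#R = 128`),
* `T(y) := Σ_{x∈L₅} σ₅(x)(−1)^{x·y} = σ₅(t)(−1)^{t·y}·S_R(y) ∈ {0, ±128}` (`S_R(y) = Σ_{r∈R} (−1)^{λ(r)+r·y} ∈ {0, 128}`),
* so the transform of the rigid proxy `S' = σ₅·1_P − 4σ₅·1_{L₅}` (the function with `e₅ ≡ S' (mod 8)` on `P`) takes values in `512ℤ`;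
* `tzv_SR_count`: `Σ_y S_R(y) = 4096`, so `S_R ≠ 0` on exactly `32` frequencies.
These are the inputs of the Parseval squeeze against the partner (next file).  NO value of `θ₁₂` is claimed; NOT summit progress.

References: MacWilliams–Sloane (1977) Ch. 14–15 (character sums over cosets of the radical of a quadratic form); C. Carlet (2021) §5.2;
R. O'Donnell (2014) §1.4.  Axioms: the standard three.
-/

set_option linter.dupNamespace false -- D-0017: single-problem summit ⇒ `QuantumAdvantage.QuantumAdvantage` by design

noncomputable section

namespace Summit.QuantumAdvantage.QuantumAdvantage.Theorems.CubicForrelation.NearExactIsExact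

open Finset
open Literature.Computability.QuantumComplexity
open Literature.Computability.QuantumComplexity.BuzetChailloux (bxor zeroVec bxor_bxor_cancel_left bxor_zeroVec zeroVec_bxor bxor_comm
  bxor_self)
open Literature.Computability.QuantumComplexity.DerivativeWalsh (W sum_W_sq twist_bxor_left)
open Literature.Computability.QuantumComplexity.Simon (twist_eq_one_or sum_twist)

/-! ### The radical under the window budget -/

/-- **`#R = 128` and `L₅` is a coset of `R`** (repackaging of `tzq_L5_flat` + `tzs_radical_eq` without the window hypothesis, only the budget).
[this work] -/
theorem tzt_R_struct (f g : (Fin (6 + 6) → Bool) → Bool) (hf : IsDegLeFun 3 f) (hg : IsDegLeFun 3 g)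
    (u' : (Fin (6 + 6) → Bool) → ℤ) (hu' : ∀ x, W (fun y => signOf (g y)) x = (2 : ℝ) ^ 5 * (u' x : ℝ))
    (V : Finset (Fin (6 + 6) → Bool)) (x₀ : Fin (6 + 6) → Bool) (h0 : zeroVec ∈ V) (hadd : ∀ a ∈ V, ∀ b ∈ V, bxor a b ∈ V)
    (hcardV : #V = 2048) (hP : (univ.filter fun x : Fin (6 + 6) → Bool => Odd (u' x)) = V.image (bxor x₀))
    (h4off : ∀ y, ¬ Odd (u' y) → (4 : ℤ) ∣ u' y - 2 * sZ (f y))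
    (hoff : ∑ y ∈ univ.filter (fun y : Fin (6 + 6) → Bool => ¬ Odd (u' y)), (u' y - 2 * sZ (f y)) ^ 2 ≤ 2047)
    (hb : (Fin (6 + 6) → Bool) → Bool) (hhb : ∀ z, hb z = decide ((u' z - 2 * sZ (f z)) % 4 = 3))
    (hbud : ∑ x ∈ univ.filter (fun x : Fin (6 + 6) → Bool => Odd (u' x)), ((u' x - 2 * sZ (f x)) ^ 2 - 1) ≤ 1535)
    (hL : ∃ x, Odd (u' x) ∧ ¬ (8 : ℤ) ∣ u' x - 2 * sZ (f x) - sZ (hb x)) :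
    #(V.filter fun r => ∀ v ∈ V, (hb x₀ ^^ hb (bxor x₀ r) ^^ hb (bxor x₀ v) ^^ hb (bxor (bxor x₀ r) v)) = false) = 128 ∧
    ∀ t, Odd (u' t) → ¬ (8 : ℤ) ∣ u' t - 2 * sZ (f t) - sZ (hb t) → (univ.filter fun z : Fin (6 + 6) → Bool => Odd (u' z) ∧ ¬ (8 : ℤ) ∣ u' z - 2 * sZ (f z) - sZ (hb z)) = (V.filter fun r => ∀ v ∈ V, (hb x₀ ^^ hb (bxor x₀ r) ^^ hb (bxor x₀ v) ^^ hb (bxor (bxor x₀ r) v)) = false).image (bxor t) := by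
  obtain ⟨-, R₇, hsub, -, -, hRcard, hper, hstr⟩ := tzq_L5_flat f g hf hg u' hu' V x₀ h0 hadd hcardV hP h4off hoff hb hhb hbud hL
  obtain ⟨hReq, hRcard'⟩ := tzs_radical_eq f g hf hg u' hu' V x₀ h0 hadd hcardV hP h4off hoff hb hhb hbud hL R₇ hsub hRcard hper
  exact ⟨hRcard', fun t ht htL => by rw [hReq]; exact hstr t ht htL⟩

/-! ### Equivariance of the sign bit under the radical -/

/-- **`R`-equivariance of the sign bit on `P`**: for `r` in the radical and `x ∈ P`, `hb(x ⊕ r) = hb(x) ⊕ (hb(x₀) ⊕ hb(x₀ ⊕ r))` (the radical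
condition read at `v = x₀ ⊕ x`). [this work] -/
theorem tzt_equivariant (u' : (Fin (6 + 6) → Bool) → ℤ) (V : Finset (Fin (6 + 6) → Bool)) (x₀ : Fin (6 + 6) → Bool)
    (hP : (univ.filter fun x : Fin (6 + 6) → Bool => Odd (u' x)) = V.image (bxor x₀)) (hb : (Fin (6 + 6) → Bool) → Bool)
    {r : Fin (6 + 6) → Bool} (hr : r ∈ (V.filter fun r => ∀ v ∈ V, (hb x₀ ^^ hb (bxor x₀ r) ^^ hb (bxor x₀ v) ^^ hb (bxor (bxor x₀ r) v)) = false)) {x : Fin (6 + 6) → Bool} (hx : Odd (u' x)) :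
    hb (bxor x r) = (hb x ^^ (hb x₀ ^^ hb (bxor x₀ r))) := by
  have hv : bxor x₀ x ∈ V := fl1_coset_diff hP (mem_filter.2 ⟨mem_univ _, hx⟩)
  have hB := (mem_filter.1 hr).2 (bxor x₀ x) hv
  have e1 : bxor x₀ (bxor x₀ x) = x := bxor_bxor_cancel_left x₀ x
  have e2 : bxor (bxor x₀ r) (bxor x₀ x) = bxor x r := by
    rw [iw_bxor_assoc, bxor_comm r (bxor x₀ x), ← iw_bxor_assoc, bxor_bxor_cancel_left]
  rw [e1, e2] at hB
  revert hB
  cases hb x₀ <;> cases hb (bxor x₀ r) <;> cases hb x <;> cases hb (bxor x r) <;> decide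

/-! ### The character sums `M`, `S_R`, `T` -/

/-- **`M(y) ∈ {0, ±512}`** in the rigid case on the window budget: `M(y)² = 2048·S_R(y)` (`tzl5_Shat_sq`), `S_R(y) ∈ {0, #R}` (`tzl5_SR`) and
`#R = 128`. [this work] -/
theorem tzt_M_val (f g : (Fin (6 + 6) → Bool) → Bool) (hf : IsDegLeFun 3 f) (hg : IsDegLeFun 3 g)
    (u' : (Fin (6 + 6) → Bool) → ℤ) (hu' : ∀ x, W (fun y => signOf (g y)) x = (2 : ℝ) ^ 5 * (u' x : ℝ))
    (V : Finset (Fin (6 + 6) → Bool)) (x₀ : Fin (6 + 6) → Bool) (h0 : zeroVec ∈ V) (hadd : ∀ a ∈ V, ∀ b ∈ V, bxor a b ∈ V)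
    (hcardV : #V = 2048) (hP : (univ.filter fun x : Fin (6 + 6) → Bool => Odd (u' x)) = V.image (bxor x₀))
    (h4off : ∀ y, ¬ Odd (u' y) → (4 : ℤ) ∣ u' y - 2 * sZ (f y))
    (hoff : ∑ y ∈ univ.filter (fun y : Fin (6 + 6) → Bool => ¬ Odd (u' y)), (u' y - 2 * sZ (f y)) ^ 2 ≤ 2047)
    (hb : (Fin (6 + 6) → Bool) → Bool) (hhb : ∀ z, hb z = decide ((u' z - 2 * sZ (f z)) % 4 = 3))
    (hbud : ∑ x ∈ univ.filter (fun x : Fin (6 + 6) → Bool => Odd (u' x)), ((u' x - 2 * sZ (f x)) ^ 2 - 1) ≤ 1535)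
    (hL : ∃ x, Odd (u' x) ∧ ¬ (8 : ℤ) ∣ u' x - 2 * sZ (f x) - sZ (hb x)) (y : Fin (6 + 6) → Bool) :
    ∑ x ∈ (univ.filter fun x : Fin (6 + 6) → Bool => Odd (u' x)), signOf (hb x) * twist x y = 0 ∨
      ∑ x ∈ (univ.filter fun x : Fin (6 + 6) → Bool => Odd (u' x)), signOf (hb x) * twist x y = 512 ∨
      ∑ x ∈ (univ.filter fun x : Fin (6 + 6) → Bool => Odd (u' x)), signOf (hb x) * twist x y = -512 := by
  classical
  have hbe : ∀ z, hb z = decide ((u' z - 2 * sZ (f z)) % 4 = 3) := hhb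
  have hsd := tzl5_hsd f g hf hg u' hu' V x₀ h0 hadd hcardV hP h4off
  have hsd' : ∀ x, Odd (u' x) → ∀ p ∈ V, ∀ q ∈ V, hb (bxor (bxor x p) q) =
      (hb x ^^ hb (bxor x p) ^^ hb (bxor x q) ^^ (hb x₀ ^^ hb (bxor x₀ p) ^^ hb (bxor x₀ q) ^^ hb (bxor (bxor x₀ p) q))) := by
    intro x hx p hp q hq
    simp only [hbe]
    exact hsd x hx p hp q hq
  have hsq := tzl5_Shat_sq u' V x₀ h0 hadd hcardV hP hb hsd' y
  have hSR := tzl5_SR u' V x₀ h0 hadd hP hb hsd' y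
  obtain ⟨hRcard, -⟩ := tzt_R_struct f g hf hg u' hu' V x₀ h0 hadd hcardV hP h4off hoff hb hhb hbud hL
  rw [hRcard] at hSR
  set M := ∑ x ∈ (univ.filter fun x : Fin (6 + 6) → Bool => Odd (u' x)), signOf (hb x) * twist x y with hM
  rcases hSR with h0' | h128
  · rw [h0', mul_zero] at hsq
    left; exact pow_eq_zero_iff (n := 2) (by norm_num) |>.1 hsq
  · rw [h128] at hsq
    norm_num at hsq
    have : (M - 512) * (M + 512) = 0 := by nlinarith
    rcases mul_eq_zero.1 this with h | h
    · right; left; linarith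
    · right; right; linarith

/-- **`S_R(y) ∈ {0, 128}`** in the rigid case on the window budget. [this work] -/
theorem tzt_SR_val (f g : (Fin (6 + 6) → Bool) → Bool) (hf : IsDegLeFun 3 f) (hg : IsDegLeFun 3 g)
    (u' : (Fin (6 + 6) → Bool) → ℤ) (hu' : ∀ x, W (fun y => signOf (g y)) x = (2 : ℝ) ^ 5 * (u' x : ℝ))
    (V : Finset (Fin (6 + 6) → Bool)) (x₀ : Fin (6 + 6) → Bool) (h0 : zeroVec ∈ V) (hadd : ∀ a ∈ V, ∀ b ∈ V, bxor a b ∈ V)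
    (hcardV : #V = 2048) (hP : (univ.filter fun x : Fin (6 + 6) → Bool => Odd (u' x)) = V.image (bxor x₀))
    (h4off : ∀ y, ¬ Odd (u' y) → (4 : ℤ) ∣ u' y - 2 * sZ (f y))
    (hoff : ∑ y ∈ univ.filter (fun y : Fin (6 + 6) → Bool => ¬ Odd (u' y)), (u' y - 2 * sZ (f y)) ^ 2 ≤ 2047)
    (hb : (Fin (6 + 6) → Bool) → Bool) (hhb : ∀ z, hb z = decide ((u' z - 2 * sZ (f z)) % 4 = 3))
    (hbud : ∑ x ∈ univ.filter (fun x : Fin (6 + 6) → Bool => Odd (u' x)), ((u' x - 2 * sZ (f x)) ^ 2 - 1) ≤ 1535)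
    (hL : ∃ x, Odd (u' x) ∧ ¬ (8 : ℤ) ∣ u' x - 2 * sZ (f x) - sZ (hb x)) (y : Fin (6 + 6) → Bool) :
    (∑ t ∈ (V.filter fun r => ∀ v ∈ V, (hb x₀ ^^ hb (bxor x₀ r) ^^ hb (bxor x₀ v) ^^ hb (bxor (bxor x₀ r) v)) = false), signOf (hb x₀ ^^ hb (bxor x₀ t)) * twist t y) = 0 ∨ (∑ t ∈ (V.filter fun r => ∀ v ∈ V, (hb x₀ ^^ hb (bxor x₀ r) ^^ hb (bxor x₀ v) ^^ hb (bxor (bxor x₀ r) v)) = false), signOf (hb x₀ ^^ hb (bxor x₀ t)) * twist t y) = 128 := by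
  classical
  have hbe : ∀ z, hb z = decide ((u' z - 2 * sZ (f z)) % 4 = 3) := hhb
  have hsd := tzl5_hsd f g hf hg u' hu' V x₀ h0 hadd hcardV hP h4off
  have hsd' : ∀ x, Odd (u' x) → ∀ p ∈ V, ∀ q ∈ V, hb (bxor (bxor x p) q) =
      (hb x ^^ hb (bxor x p) ^^ hb (bxor x q) ^^ (hb x₀ ^^ hb (bxor x₀ p) ^^ hb (bxor x₀ q) ^^ hb (bxor (bxor x₀ p) q))) := by
    intro x hx p hp q hq
    simp only [hbe]
    exact hsd x hx p hp q hq
  have hSR := tzl5_SR u' V x₀ h0 hadd hP hb hsd' y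
  obtain ⟨hRcard, -⟩ := tzt_R_struct f g hf hg u' hu' V x₀ h0 hadd hcardV hP h4off hoff hb hhb hbud hL
  rw [hRcard] at hSR
  rcases hSR with h | h
  · exact Or.inl h
  · right; rw [h]; norm_num

/-- **The coset character sum `T(y) = Σ_{x∈L₅} σ₅(x)(−1)^{x·y}` factors as `σ₅(t)(−1)^{t·y}·S_R(y)`** for any `t ∈ L₅` (equivariance;
`L₅ = t ⊕ R`). [this work] -/
theorem tzt_T_eq (f g : (Fin (6 + 6) → Bool) → Bool) (hf : IsDegLeFun 3 f) (hg : IsDegLeFun 3 g)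
    (u' : (Fin (6 + 6) → Bool) → ℤ) (hu' : ∀ x, W (fun y => signOf (g y)) x = (2 : ℝ) ^ 5 * (u' x : ℝ))
    (V : Finset (Fin (6 + 6) → Bool)) (x₀ : Fin (6 + 6) → Bool) (h0 : zeroVec ∈ V) (hadd : ∀ a ∈ V, ∀ b ∈ V, bxor a b ∈ V)
    (hcardV : #V = 2048) (hP : (univ.filter fun x : Fin (6 + 6) → Bool => Odd (u' x)) = V.image (bxor x₀))
    (h4off : ∀ y, ¬ Odd (u' y) → (4 : ℤ) ∣ u' y - 2 * sZ (f y))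
    (hoff : ∑ y ∈ univ.filter (fun y : Fin (6 + 6) → Bool => ¬ Odd (u' y)), (u' y - 2 * sZ (f y)) ^ 2 ≤ 2047)
    (hb : (Fin (6 + 6) → Bool) → Bool) (hhb : ∀ z, hb z = decide ((u' z - 2 * sZ (f z)) % 4 = 3))
    (hbud : ∑ x ∈ univ.filter (fun x : Fin (6 + 6) → Bool => Odd (u' x)), ((u' x - 2 * sZ (f x)) ^ 2 - 1) ≤ 1535)
    (hL : ∃ x, Odd (u' x) ∧ ¬ (8 : ℤ) ∣ u' x - 2 * sZ (f x) - sZ (hb x)) {t : Fin (6 + 6) → Bool} (ht : Odd (u' t)) (htL : ¬ (8 : ℤ) ∣ u' t - 2 * sZ (f t) - sZ (hb t)) (y : Fin (6 + 6) → Bool) :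
    ∑ x ∈ (univ.filter fun z : Fin (6 + 6) → Bool => Odd (u' z) ∧ ¬ (8 : ℤ) ∣ u' z - 2 * sZ (f z) - sZ (hb z)), signOf (hb x) * twist x y = signOf (hb t) * twist t y * (∑ t ∈ (V.filter fun r => ∀ v ∈ V, (hb x₀ ^^ hb (bxor x₀ r) ^^ hb (bxor x₀ v) ^^ hb (bxor (bxor x₀ r) v)) = false), signOf (hb x₀ ^^ hb (bxor x₀ t)) * twist t y) := by
  classical
  obtain ⟨-, hcos⟩ := tzt_R_struct f g hf hg u' hu' V x₀ h0 hadd hcardV hP h4off hoff hb hhb hbud hL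
  rw [hcos t ht htL, sum_image (fun a _ b _ h => iw_bxor_injective t h), mul_sum]
  refine sum_congr rfl fun r hr => ?_
  have hsx : ∀ a b : Bool, signOf (a ^^ b) = signOf a * signOf b := fun a b => by
    cases a <;> cases b <;> simp [signOf]
  rw [tzt_equivariant u' V x₀ hP hb hr ht, hsx, twist_bxor_left]
  ring

/-- **`T(y) ∈ {0, ±128}`** for the coset character sum of `L₅`. [this work] -/
theorem tzt_T_val (f g : (Fin (6 + 6) → Bool) → Bool) (hf : IsDegLeFun 3 f) (hg : IsDegLeFun 3 g)
    (u' : (Fin (6 + 6) → Bool) → ℤ) (hu' : ∀ x, W (fun y => signOf (g y)) x = (2 : ℝ) ^ 5 * (u' x : ℝ))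
    (V : Finset (Fin (6 + 6) → Bool)) (x₀ : Fin (6 + 6) → Bool) (h0 : zeroVec ∈ V) (hadd : ∀ a ∈ V, ∀ b ∈ V, bxor a b ∈ V)
    (hcardV : #V = 2048) (hP : (univ.filter fun x : Fin (6 + 6) → Bool => Odd (u' x)) = V.image (bxor x₀))
    (h4off : ∀ y, ¬ Odd (u' y) → (4 : ℤ) ∣ u' y - 2 * sZ (f y))
    (hoff : ∑ y ∈ univ.filter (fun y : Fin (6 + 6) → Bool => ¬ Odd (u' y)), (u' y - 2 * sZ (f y)) ^ 2 ≤ 2047)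
    (hb : (Fin (6 + 6) → Bool) → Bool) (hhb : ∀ z, hb z = decide ((u' z - 2 * sZ (f z)) % 4 = 3))
    (hbud : ∑ x ∈ univ.filter (fun x : Fin (6 + 6) → Bool => Odd (u' x)), ((u' x - 2 * sZ (f x)) ^ 2 - 1) ≤ 1535)
    (hL : ∃ x, Odd (u' x) ∧ ¬ (8 : ℤ) ∣ u' x - 2 * sZ (f x) - sZ (hb x)) (y : Fin (6 + 6) → Bool) :
    ∑ x ∈ (univ.filter fun z : Fin (6 + 6) → Bool => Odd (u' z) ∧ ¬ (8 : ℤ) ∣ u' z - 2 * sZ (f z) - sZ (hb z)), signOf (hb x) * twist x y = 0 ∨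
      ∑ x ∈ (univ.filter fun z : Fin (6 + 6) → Bool => Odd (u' z) ∧ ¬ (8 : ℤ) ∣ u' z - 2 * sZ (f z) - sZ (hb z)), signOf (hb x) * twist x y = 128 ∨
      ∑ x ∈ (univ.filter fun z : Fin (6 + 6) → Bool => Odd (u' z) ∧ ¬ (8 : ℤ) ∣ u' z - 2 * sZ (f z) - sZ (hb z)), signOf (hb x) * twist x y = -128 := by
  classical
  obtain ⟨t, ht, htL⟩ := hL
  rw [tzt_T_eq f g hf hg u' hu' V x₀ h0 hadd hcardV hP h4off hoff hb hhb hbud ⟨t, ht, htL⟩ ht htL y]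
  rcases tzt_SR_val f g hf hg u' hu' V x₀ h0 hadd hcardV hP h4off hoff hb hhb hbud ⟨t, ht, htL⟩ y with h | h
  · left; rw [h, mul_zero]
  · rw [h]
    have hs : signOf (hb t) = 1 ∨ signOf (hb t) = -1 := by cases hb t <;> simp [signOf]
    have htw : twist t y = 1 ∨ twist t y = -1 := Literature.Computability.QuantumComplexity.Simon.twist_eq_one_or t y
    rcases hs with hs | hs <;> rcases htw with htw | htw <;> · rw [hs, htw]; norm_num

/-! ### The transform of the rigid proxy is in `512ℤ` -/

/-- **`Ŝ'(y) ∈ 512ℤ`** for the rigid proxy `S' = σ₅·1_P − 4σ₅·1_{L₅}`: `Ŝ' = M − 4T` with `M ∈ {0, ±512}`, `T ∈ {0, ±128}`. [this work] -/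
theorem tzt_Shat_val (f g : (Fin (6 + 6) → Bool) → Bool) (hf : IsDegLeFun 3 f) (hg : IsDegLeFun 3 g)
    (u' : (Fin (6 + 6) → Bool) → ℤ) (hu' : ∀ x, W (fun y => signOf (g y)) x = (2 : ℝ) ^ 5 * (u' x : ℝ))
    (V : Finset (Fin (6 + 6) → Bool)) (x₀ : Fin (6 + 6) → Bool) (h0 : zeroVec ∈ V) (hadd : ∀ a ∈ V, ∀ b ∈ V, bxor a b ∈ V)
    (hcardV : #V = 2048) (hP : (univ.filter fun x : Fin (6 + 6) → Bool => Odd (u' x)) = V.image (bxor x₀))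
    (h4off : ∀ y, ¬ Odd (u' y) → (4 : ℤ) ∣ u' y - 2 * sZ (f y))
    (hoff : ∑ y ∈ univ.filter (fun y : Fin (6 + 6) → Bool => ¬ Odd (u' y)), (u' y - 2 * sZ (f y)) ^ 2 ≤ 2047)
    (hb : (Fin (6 + 6) → Bool) → Bool) (hhb : ∀ z, hb z = decide ((u' z - 2 * sZ (f z)) % 4 = 3))
    (hbud : ∑ x ∈ univ.filter (fun x : Fin (6 + 6) → Bool => Odd (u' x)), ((u' x - 2 * sZ (f x)) ^ 2 - 1) ≤ 1535)
    (hL : ∃ x, Odd (u' x) ∧ ¬ (8 : ℤ) ∣ u' x - 2 * sZ (f x) - sZ (hb x)) (y : Fin (6 + 6) → Bool) :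
    ∃ k : ℤ, (k = 0 ∨ k = 1 ∨ k = -1 ∨ k = 2 ∨ k = -2) ∧
      ∑ x ∈ (univ.filter fun x : Fin (6 + 6) → Bool => Odd (u' x)), signOf (hb x) * twist x y - 4 * ∑ x ∈ (univ.filter fun z : Fin (6 + 6) → Bool => Odd (u' z) ∧ ¬ (8 : ℤ) ∣ u' z - 2 * sZ (f z) - sZ (hb z)), signOf (hb x) * twist x y = 512 * (k : ℝ) := by
  rcases tzt_M_val f g hf hg u' hu' V x₀ h0 hadd hcardV hP h4off hoff hb hhb hbud hL y with hM | hM | hM <;>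
    rcases tzt_T_val f g hf hg u' hu' V x₀ h0 hadd hcardV hP h4off hoff hb hhb hbud hL y with hT | hT | hT <;> rw [hM, hT]
  · exact ⟨0, by norm_num, by norm_num⟩
  · exact ⟨-1, by norm_num, by norm_num⟩
  · exact ⟨1, by norm_num, by norm_num⟩
  · exact ⟨1, by norm_num, by norm_num⟩
  · exact ⟨0, by norm_num, by norm_num⟩
  · exact ⟨2, by norm_num, by norm_num⟩
  · exact ⟨-1, by norm_num, by norm_num⟩
  · exact ⟨-2, by norm_num, by norm_num⟩
  · exact ⟨0, by norm_num, by norm_num⟩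

/-! ### The support of `S_R` -/

/-- **`Σ_y S_R(y) = 4096`, so `S_R ≠ 0` on exactly `32` frequencies** (rigid case on the window budget). [this work] -/
theorem tzv_SR_count (f g : (Fin (6 + 6) → Bool) → Bool) (hf : IsDegLeFun 3 f) (hg : IsDegLeFun 3 g)
    (u' : (Fin (6 + 6) → Bool) → ℤ) (hu' : ∀ x, W (fun y => signOf (g y)) x = (2 : ℝ) ^ 5 * (u' x : ℝ))
    (V : Finset (Fin (6 + 6) → Bool)) (x₀ : Fin (6 + 6) → Bool) (h0 : zeroVec ∈ V) (hadd : ∀ a ∈ V, ∀ b ∈ V, bxor a b ∈ V)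
    (hcardV : #V = 2048) (hP : (univ.filter fun x : Fin (6 + 6) → Bool => Odd (u' x)) = V.image (bxor x₀))
    (h4off : ∀ y, ¬ Odd (u' y) → (4 : ℤ) ∣ u' y - 2 * sZ (f y))
    (hoff : ∑ y ∈ univ.filter (fun y : Fin (6 + 6) → Bool => ¬ Odd (u' y)), (u' y - 2 * sZ (f y)) ^ 2 ≤ 2047)
    (hb : (Fin (6 + 6) → Bool) → Bool) (hhb : ∀ z, hb z = decide ((u' z - 2 * sZ (f z)) % 4 = 3))
    (hbud : ∑ x ∈ univ.filter (fun x : Fin (6 + 6) → Bool => Odd (u' x)), ((u' x - 2 * sZ (f x)) ^ 2 - 1) ≤ 1535)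
    (hL : ∃ x, Odd (u' x) ∧ ¬ (8 : ℤ) ∣ u' x - 2 * sZ (f x) - sZ (hb x)) :
    #(univ.filter fun y : Fin (6 + 6) → Bool => (∑ t ∈ (V.filter fun r => ∀ v ∈ V, (hb x₀ ^^ hb (bxor x₀ r) ^^ hb (bxor x₀ v) ^^ hb (bxor (bxor x₀ r) v)) = false), signOf (hb x₀ ^^ hb (bxor x₀ t)) * twist t y) ≠ 0) = 32 := by
  classical
  set R := (V.filter fun r => ∀ v ∈ V, (hb x₀ ^^ hb (bxor x₀ r) ^^ hb (bxor x₀ v) ^^ hb (bxor (bxor x₀ r) v)) = false) with hRdef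
  have h0R : zeroVec ∈ R := by
    refine mem_filter.2 ⟨h0, fun v _ => ?_⟩
    rw [bxor_zeroVec]
    cases hb x₀ <;> cases hb (bxor x₀ v) <;> rfl
  -- `Σ_y S_R(y) = 4096`
  have hsum : ∑ y : Fin (6 + 6) → Bool, ∑ t ∈ R, signOf (hb x₀ ^^ hb (bxor x₀ t)) * twist t y = 4096 := by
    rw [sum_comm]
    have hin : ∀ t ∈ R, ∑ y : Fin (6 + 6) → Bool, signOf (hb x₀ ^^ hb (bxor x₀ t)) * twist t y =
        if zeroVec = t then 4096 else 0 := by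
      intro t _
      rw [← mul_sum, sum_twist]
      by_cases ht : t = zeroVec
      · rw [if_pos (show t = (fun _ => false) from ht), if_pos ht.symm, ht, bxor_zeroVec]
        cases hb x₀ <;> norm_num [signOf]
      · rw [if_neg (show ¬ (t = fun _ => false) from ht), if_neg (fun h => ht h.symm), mul_zero]
    rw [sum_congr rfl hin, sum_ite_eq, if_pos h0R]
  -- pointwise `S_R ∈ {0, 128}`
  have hval : ∀ y, ∑ t ∈ R, signOf (hb x₀ ^^ hb (bxor x₀ t)) * twist t y =
      if (∑ t ∈ R, signOf (hb x₀ ^^ hb (bxor x₀ t)) * twist t y) ≠ 0 then (128 : ℝ) else 0 := by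
    intro y
    rcases tzt_SR_val f g hf hg u' hu' V x₀ h0 hadd hcardV hP h4off hoff hb hhb hbud hL y with h | h
    · rw [h]; simp
    · rw [h]; norm_num
  rw [sum_congr rfl fun y _ => hval y, sum_ite, sum_const_zero, add_zero, sum_const, nsmul_eq_mul] at hsum
  have : ((#(univ.filter fun y : Fin (6 + 6) → Bool => ∑ t ∈ R, signOf (hb x₀ ^^ hb (bxor x₀ t)) * twist t y ≠ 0) : ℕ) : ℝ) = 32 := by
    linarith
  exact_mod_cast this


end Summit.QuantumAdvantage.QuantumAdvantage.Theorems.CubicForrelation.NearExactIsExact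

end
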